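import Summits.QuantumFields.YangMills.Theorems.ColdStartUniversalityLatticeLangevinEntropyFisherLimits
import Summits.QuantumFields.YangMills.Theorems.ColdStartUniversalityLatticeLangevinBakryEmeryPoincare
import Mathlib.Analysis.Calculus.BumpFunction.SmoothApprox
import Mathlib.Topology.UniformSpace.HeineCantor
import HarnessLib

/-!
# Route `ColdStartUniversality` (fixed-cut-off package, Bakry–Émery side, log-Sobolev half): exponential entropy decay passes
# from SMOOTH (`C⁵`, compactly supported) to CONTINUOUS positive cylinder densities

Helper file (seat `ym-line-csu-p1`, g26; `--supports stmt-QuantumFields-24809`).  For the SU(2) lattice Langevin dynamics of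
Shen–Zhu–Zhu on `(ℤ/L)³` at a FIXED cut-off and coupling `β'` (`μ = μ_(β')`, `κ_t` any realising Markov kernel family):
* ★ `exists_contDiff_cylinder_approx` — every continuous function of the real link coordinates is, ON THE RANGE OF `coords` (a compact
  set), the uniform limit of `C⁵` compactly supported functions (Mathlib's `UniformContinuous.exists_contDiff_dist_le` — mollification —
  applied to a compactly supported copy, then cut off again);
* ★★ `entropy_decay_of_entropy_decay_smooth` — if `Ent_μ(κ_tQ) ≤ e^(−ct) Ent_μ(Q)` (`c ≥ 0`) holds for every positive `C⁵` compactly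
  supported cylinder density `Q = q∘coords`, then it holds for every positive CONTINUOUS cylinder density (`u log u` is Lipschitz on
  `[δ/2, M+1]`, the kernels are probability measures, `le_of_forall_pos_le_add`).
This upgrades the `C⁵` entropy decay of `…EntropyDecayOfEntropicCurvature` to the `C³` class quantified in g22's converse
`generatorLogSobolev_of_entropy_decay`.  THEOREMS ONLY, no definition, no sorry.  HONEST FRAMING: fixed cut-off; nothing K-uniform;
no crux, rung or summit statement is proved; the Yang–Mills mass gap is NOT proved.
-/

set_option autoImplicit false

noncomputable section

namespace Summit.QuantumFields.YangMills.Theorems.ColdStartUniversality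

open MeasureTheory ProbabilityTheory Finset Filter Set Metric
open scoped BigOperators NNReal ENNReal Topology
open Literature.Probability.Process Literature.MathematicalPhysics.QuantumFieldTheory
open Literature.MathematicalPhysics.QuantumLattice (fundamentalRep fundamentalLatticeRep continuous_fundamentalRep)

variable {L : ℕ} [NeZero L]

/-! ## §1. Smooth compactly supported approximation on the range of the coordinates -/

/-- ★ **Uniform approximation by `C⁵` compactly supported functions on the range of `coords`.**  For every continuous `q` and `ε > 0`
there is a `C⁵` compactly supported `q'` with `|q'(coords x) − q(coords x)| < ε` for all `x ∈ SU(2)^E`. [folklore] -/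
theorem exists_contDiff_cylinder_approx (L : ℕ) [NeZero L] {q : (Edge 3 L × Fin 2 × Fin 2 × Bool → ℝ) → ℝ} (hq : Continuous q) {ε : ℝ} (hε : 0 < ε) :
    let coords : GaugeConfig 3 L (Matrix.specialUnitaryGroup (Fin 2) ℂ) → (Edge 3 L × Fin 2 × Fin 2 × Bool → ℝ) :=
      fun V q => (fun z : ℂ => if q.2.2.2 then z.im else z.re)
        ((fundamentalRep (Fin 2) (V q.1) : Matrix (Fin 2) (Fin 2) ℂ) q.2.1 q.2.2.1)
    ∃ q' : (Edge 3 L × Fin 2 × Fin 2 × Bool → ℝ) → ℝ, ContDiff ℝ 5 q' ∧ HasCompactSupport q' ∧ ∀ x, |q' (coords x) - q (coords x)| < ε := by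
  intro coords
  let χ : ContDiffBump (0 : (Edge 3 L × Fin 2 × Fin 2 × Bool → ℝ)) := ⟨2, 3, by norm_num, by norm_num⟩
  set f : (Edge 3 L × Fin 2 × Fin 2 × Bool → ℝ) → ℝ := fun y => (χ : (Edge 3 L × Fin 2 × Fin 2 × Bool → ℝ) → ℝ) y * q y with hfdef
  have hfc : Continuous f := χ.continuous.mul hq
  have hfK : HasCompactSupport f := χ.hasCompactSupport.mul_right
  have hfu : UniformContinuous f := hfK.uniformContinuous_of_continuous hfc
  obtain ⟨g, hg, hgε⟩ := hfu.exists_contDiff_dist_le hε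
  have hball : ∀ V : (GaugeConfig 3 L (Matrix.specialUnitaryGroup (Fin 2) ℂ)), coords V ∈ ball (0 : (Edge 3 L × Fin 2 × Fin 2 × Bool → ℝ)) 2 := by
    intro V
    rw [mem_ball, dist_zero_right]
    exact (norm_coords_le_one V).trans_lt (by norm_num)
  have hχ1 : ∀ V : (GaugeConfig 3 L (Matrix.specialUnitaryGroup (Fin 2) ℂ)), (χ : (Edge 3 L × Fin 2 × Fin 2 × Bool → ℝ) → ℝ) (coords V) = 1 := fun V =>
    χ.one_of_mem_closedBall (ball_subset_closedBall (hball V))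
  refine ⟨fun y => (χ : (Edge 3 L × Fin 2 × Fin 2 × Bool → ℝ) → ℝ) y * g y, χ.contDiff.mul (contDiff_infty.1 hg 5), χ.hasCompactSupport.mul_right, fun x => ?_⟩
  have h1 := hgε (coords x)
  rw [Real.dist_eq] at h1
  have hf1 : f (coords x) = q (coords x) := by simp only [hfdef, hχ1 x, one_mul]
  rw [hf1] at h1
  simpa only [hχ1 x, one_mul] using h1

/-! ## §2. Entropy decay: from smooth to continuous densities -/

/-- ★★ **Exponential entropy decay passes from `C⁵` compactly supported to continuous positive cylinder densities.**
If for some `c ≥ 0` every positive `C⁵` compactly supported cylinder density `Q = q∘coords` satisfies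
`Ent_μ(κ_t Q) ≤ e^(−ct)·Ent_μ(Q)` for all `t` (along a realising kernel family `κ`), then so does every positive continuous cylinder
density. [cite: BakryGentilLedoux2014, Thm 5.2.1] -/
theorem entropy_decay_of_entropy_decay_smooth (L : ℕ) [NeZero L] (β' c : ℝ) (hc : 0 ≤ c)
    (κ : ℝ≥0 → Kernel (GaugeConfig 3 L (Matrix.specialUnitaryGroup (Fin 2) ℂ))
      (GaugeConfig 3 L (Matrix.specialUnitaryGroup (Fin 2) ℂ))) [∀ t, IsMarkovKernel (κ t)]
    (hreal : ∀ (t : ℝ≥0) (x : GaugeConfig 3 L (Matrix.specialUnitaryGroup (Fin 2) ℂ))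
        (Ω : Type) [MeasurableSpace Ω] (P : Measure Ω) [IsProbabilityMeasure P]
        (W : ℝ≥0 → Ω → (Edge 3 L × NoiseIdx 2 → ℝ)) (hW : IsFlatBrownian W P)
        (U : ℝ≥0 → Ω → GaugeConfig 3 L (Matrix.specialUnitaryGroup (Fin 2) ℂ)),
        (∀ ω, U 0 ω = x) →
        (latticeLangevinDynamics (fundamentalLatticeRep 2) β').IsSolution (fundamentalRep (Fin 2))
          hW.natFiltration P W U →
        κ t x = P.map (U t))
    (hdec : ∀ (q : (Edge 3 L × Fin 2 × Fin 2 × Bool → ℝ) → ℝ), ContDiff ℝ 5 q → HasCompactSupport q →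
      let coords : GaugeConfig 3 L (Matrix.specialUnitaryGroup (Fin 2) ℂ) → (Edge 3 L × Fin 2 × Fin 2 × Bool → ℝ) :=
      fun V q => (fun z : ℂ => if q.2.2.2 then z.im else z.re)
        ((fundamentalRep (Fin 2) (V q.1) : Matrix (Fin 2) (Fin 2) ℂ) q.2.1 q.2.2.1)
      (∀ x, 0 < q (coords x)) → ∀ t : ℝ≥0,
        ((∫ x, (∫ y, q (coords y) ∂(κ t x)) * Real.log (∫ y, q (coords y) ∂(κ t x)) ∂(wilsonMeasure (d := 3) (L := L) (fundamentalRep (Fin 2)) β')) - (∫ x, (∫ y, q (coords y) ∂(κ t x)) ∂(wilsonMeasure (d := 3) (L := L) (fundamentalRep (Fin 2)) β')) * Real.log (∫ x, (∫ y, q (coords y) ∂(κ t x)) ∂(wilsonMeasure (d := 3) (L := L) (fundamentalRep (Fin 2)) β'))) ≤ Real.exp (-c * t) * ((∫ x, q (coords x) * Real.log (q (coords x)) ∂(wilsonMeasure (d := 3) (L := L) (fundamentalRep (Fin 2)) β')) - (∫ x, q (coords x) ∂(wilsonMeasure (d := 3) (L := L) (fundamentalRep (Fin 2)) β')) * Real.log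 (∫ x, q (coords x) ∂(wilsonMeasure (d := 3) (L := L) (fundamentalRep (Fin 2)) β'))))
    {q : (Edge 3 L × Fin 2 × Fin 2 × Bool → ℝ) → ℝ} (hq : Continuous q) :
    let coords : GaugeConfig 3 L (Matrix.specialUnitaryGroup (Fin 2) ℂ) → (Edge 3 L × Fin 2 × Fin 2 × Bool → ℝ) :=
      fun V q => (fun z : ℂ => if q.2.2.2 then z.im else z.re)
        ((fundamentalRep (Fin 2) (V q.1) : Matrix (Fin 2) (Fin 2) ℂ) q.2.1 q.2.2.1)
    (∀ x, 0 < q (coords x)) → ∀ t : ℝ≥0,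
      ((∫ x, (∫ y, q (coords y) ∂(κ t x)) * Real.log (∫ y, q (coords y) ∂(κ t x)) ∂(wilsonMeasure (d := 3) (L := L) (fundamentalRep (Fin 2)) β')) - (∫ x, (∫ y, q (coords y) ∂(κ t x)) ∂(wilsonMeasure (d := 3) (L := L) (fundamentalRep (Fin 2)) β')) * Real.log (∫ x, (∫ y, q (coords y) ∂(κ t x)) ∂(wilsonMeasure (d := 3) (L := L) (fundamentalRep (Fin 2)) β'))) ≤ Real.exp (-c * t) * ((∫ x, q (coords x) * Real.log (q (coords x)) ∂(wilsonMeasure (d := 3) (L := L) (fundamentalRep (Fin 2)) β')) - (∫ x, q (coords x) ∂(wilsonMeasure (d := 3) (L := L) (fundamentalRep (Fin 2)) β')) * Real.log (∫ x, q (coords x) ∂(wilsonMeasure (d := 3) (L := L) (fundamentalRep (Fin 2)) β'))) := by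
  intro coords hpos t
  classical
  haveI := secondCountableTopology_su2
  haveI := borelSpace_config L
  set μ : Measure (GaugeConfig 3 L (Matrix.specialUnitaryGroup (Fin 2) ℂ)) := (wilsonMeasure (d := 3) (L := L) (fundamentalRep (Fin 2)) β') with hμ
  haveI : IsProbabilityMeasure μ :=
    isProbabilityMeasure_wilsonMeasure (d := 3) (L := L) (fundamentalRep (Fin 2)) (continuous_fundamentalRep (Fin 2)) β'
  have hco : Continuous coords := continuous_coords (L := L)
  have hQc : Continuous fun V => q (coords V) := hq.comp hco
  -- bounds for `Q`
  obtain ⟨δ, hδ, hQδ⟩ : ∃ δ : ℝ, 0 < δ ∧ ∀ x : (GaugeConfig 3 L (Matrix.specialUnitaryGroup (Fin 2) ℂ)), δ ≤ q (coords x) := by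
    obtain ⟨x₀, -, hx₀⟩ := isCompact_univ.exists_isMinOn (Set.univ_nonempty) hQc.continuousOn
    exact ⟨q (coords x₀), hpos x₀, fun x => hx₀ (Set.mem_univ x)⟩
  obtain ⟨Mq, hMq⟩ : ∃ M, ∀ V : (GaugeConfig 3 L (Matrix.specialUnitaryGroup (Fin 2) ℂ)), q (coords V) ≤ M := by
    obtain ⟨M, hM⟩ := isCompact_univ.exists_bound_of_continuousOn hQc.continuousOn
    exact ⟨M, fun V => (le_abs_self _).trans (by simpa [Real.norm_eq_abs] using hM V (Set.mem_univ V))⟩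
  -- the Lipschitz constant of `u log u` on `[δ/2, Mq + δ/2]`
  set C : ℝ := max |Real.log (δ / 2)| |Real.log (Mq + δ / 2)| + 1 with hC
  have hC0 : 0 ≤ C := by positivity
  have hLip : ∀ u v : ℝ, u ∈ Icc (δ / 2) (Mq + δ / 2) → v ∈ Icc (δ / 2) (Mq + δ / 2) →
      |u * Real.log u - v * Real.log v| ≤ C * |u - v| := fun u v hu hv =>
    abs_mul_log_sub_mul_log_le (by linarith) hu hv
  -- the `ε`-argument
  refine le_of_forall_pos_le_add fun ε' hε' => ?_
  set ε : ℝ := min (δ / 2) (ε' / (4 * C + 4)) with hεdef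
  have hε : 0 < ε := lt_min (by linarith) (div_pos hε' (by linarith))
  have hεδ : ε ≤ δ / 2 := min_le_left _ _
  have hε4 : 4 * C * ε ≤ ε' := by
    have h1 : ε ≤ ε' / (4 * C + 4) := min_le_right _ _
    have h2 : 4 * C * ε ≤ 4 * C * (ε' / (4 * C + 4)) := mul_le_mul_of_nonneg_left h1 (by linarith)
    have h3 : 4 * C * (ε' / (4 * C + 4)) ≤ ε' := by
      rw [mul_div_assoc']
      rw [div_le_iff₀ (by linarith)]
      nlinarith
    linarith
  -- the smooth approximant
  obtain ⟨p, hp, hpc, hpε⟩ := exists_contDiff_cylinder_approx L hq hε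
  have hpε' : ∀ x : (GaugeConfig 3 L (Matrix.specialUnitaryGroup (Fin 2) ℂ)), |p (coords x) - q (coords x)| < ε := fun x => hpε x
  have hPc : Continuous fun V => p (coords V) := hp.continuous.comp hco
  have hPpos : ∀ x : (GaugeConfig 3 L (Matrix.specialUnitaryGroup (Fin 2) ℂ)), 0 < p (coords x) := fun x => by
    have h := abs_lt.1 (hpε' x); linarith [hQδ x]
  have hPrange : ∀ x : (GaugeConfig 3 L (Matrix.specialUnitaryGroup (Fin 2) ℂ)), p (coords x) ∈ Icc (δ / 2) (Mq + δ / 2) := fun x => by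
    have h := abs_lt.1 (hpε' x); exact ⟨by linarith [hQδ x], by linarith [hMq x]⟩
  have hQrange : ∀ x : (GaugeConfig 3 L (Matrix.specialUnitaryGroup (Fin 2) ℂ)), q (coords x) ∈ Icc (δ / 2) (Mq + δ / 2) := fun x =>
    ⟨by linarith [hQδ x], by linarith [hMq x]⟩
  -- the decay for `p`
  have hdp : ((∫ x, (∫ y, p (coords y) ∂(κ t x)) * Real.log (∫ y, p (coords y) ∂(κ t x)) ∂μ) - (∫ x, (∫ y, p (coords y) ∂(κ t x)) ∂μ) * Real.log (∫ x, (∫ y, p (coords y) ∂(κ t x)) ∂μ)) ≤ Real.exp (-c * t) * ((∫ x, p (coords x) * Real.log (p (coords x)) ∂μ) - (∫ x, p (coords x) ∂μ) * Real.log (∫ x, p (coords x) ∂μ)) := hdec p hp hpc hPpos t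
  -- kernel images: ranges and closeness
  obtain ⟨a, ha⟩ : ∃ a : (GaugeConfig 3 L (Matrix.specialUnitaryGroup (Fin 2) ℂ)) → ℝ, a = fun x => (∫ y, q (coords y) ∂(κ t x)) := ⟨_, rfl⟩
  obtain ⟨b, hb⟩ : ∃ b : (GaugeConfig 3 L (Matrix.specialUnitaryGroup (Fin 2) ℂ)) → ℝ, b = fun x => (∫ y, p (coords y) ∂(κ t x)) := ⟨_, rfl⟩
  have hac : Continuous a := by rw [ha]; exact continuous_integral_transitionKernel L β' κ hreal t hQc
  have hbc : Continuous b := by rw [hb]; exact continuous_integral_transitionKernel L β' κ hreal t hPc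
  have harange : ∀ x, a x ∈ Icc (δ / 2) (Mq + δ / 2) := fun x => by
    rw [ha]
    haveI : IsProbabilityMeasure (κ t x) := IsMarkovKernel.isProbabilityMeasure x
    constructor
    · exact le_transition_of_le L κ hQc (fun y => (hQrange y).1) t x
    · calc (∫ y, q (coords y) ∂(κ t x)) ≤ ∫ _y, (Mq + δ / 2) ∂(κ t x) :=
            integral_mono (integrable_of_continuous_of_compactSpace hQc _) (integrable_const _) fun y => (hQrange y).2
        _ = Mq + δ / 2 := by simp
  have hbrange : ∀ x, b x ∈ Icc (δ / 2) (Mq + δ / 2) := fun x => by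
    rw [hb]
    haveI : IsProbabilityMeasure (κ t x) := IsMarkovKernel.isProbabilityMeasure x
    constructor
    · exact le_transition_of_le L κ hPc (fun y => (hPrange y).1) t x
    · calc (∫ y, p (coords y) ∂(κ t x)) ≤ ∫ _y, (Mq + δ / 2) ∂(κ t x) :=
            integral_mono (integrable_of_continuous_of_compactSpace hPc _) (integrable_const _) fun y => (hPrange y).2
        _ = Mq + δ / 2 := by simp
  have hab : ∀ x, |b x - a x| ≤ ε := fun x => by
    rw [ha, hb]
    haveI : IsProbabilityMeasure (κ t x) := IsMarkovKernel.isProbabilityMeasure x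
    have hi1 : Integrable (fun y => p (coords y)) (κ t x) := integrable_of_continuous_of_compactSpace hPc _
    have hi2 : Integrable (fun y => q (coords y)) (κ t x) := integrable_of_continuous_of_compactSpace hQc _
    rw [← integral_sub hi1 hi2]
    refine (abs_integral_le_integral_abs).trans ?_
    calc ∫ y, |p (coords y) - q (coords y)| ∂(κ t x) ≤ ∫ _y, ε ∂(κ t x) :=
          integral_mono (hi1.sub hi2).abs (integrable_const _) fun y => (hpε' y).le
      _ = ε := by simp
  -- means: ranges and closeness
  have hmean_range : ∀ {u : (GaugeConfig 3 L (Matrix.specialUnitaryGroup (Fin 2) ℂ)) → ℝ}, Continuous u → (∀ x, u x ∈ Icc (δ / 2) (Mq + δ / 2)) →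
      (∫ x, u x ∂μ) ∈ Icc (δ / 2) (Mq + δ / 2) := by
    intro u hu hur
    constructor
    · calc δ / 2 = ∫ _x, δ / 2 ∂μ := by simp
        _ ≤ ∫ x, u x ∂μ := integral_mono (integrable_const _) (integrable_of_continuous_of_compactSpace hu _) fun x => (hur x).1
    · calc (∫ x, u x ∂μ) ≤ ∫ _x, (Mq + δ / 2) ∂μ :=
            integral_mono (integrable_of_continuous_of_compactSpace hu _) (integrable_const _) fun x => (hur x).2
        _ = Mq + δ / 2 := by simp
  have hmean_close : ∀ {u v : (GaugeConfig 3 L (Matrix.specialUnitaryGroup (Fin 2) ℂ)) → ℝ}, Continuous u → Continuous v → (∀ x, |u x - v x| ≤ ε) →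
      |(∫ x, u x ∂μ) - ∫ x, v x ∂μ| ≤ ε := by
    intro u v hu hv huv
    have hiu : Integrable u μ := integrable_of_continuous_of_compactSpace hu _
    have hiv : Integrable v μ := integrable_of_continuous_of_compactSpace hv _
    rw [← integral_sub hiu hiv]
    refine (abs_integral_le_integral_abs).trans ?_
    calc ∫ x, |u x - v x| ∂μ ≤ ∫ _x, ε ∂μ := integral_mono (hiu.sub hiv).abs (integrable_const _) fun x => huv x
      _ = ε := by simp
  -- entropy functionals are `2Cε`-close
  have hEnt_close : ∀ {u v : (GaugeConfig 3 L (Matrix.specialUnitaryGroup (Fin 2) ℂ)) → ℝ}, Continuous u → Continuous v → (∀ x, u x ∈ Icc (δ / 2) (Mq + δ / 2)) →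
      (∀ x, v x ∈ Icc (δ / 2) (Mq + δ / 2)) → (∀ x, |u x - v x| ≤ ε) →
      ((∫ x, u x * Real.log (u x) ∂μ) - (∫ x, u x ∂μ) * Real.log (∫ x, u x ∂μ)) ≤
        ((∫ x, v x * Real.log (v x) ∂μ) - (∫ x, v x ∂μ) * Real.log (∫ x, v x ∂μ)) + 2 * C * ε := by
    intro u v hu hv hur hvr huv
    have hul : Continuous fun x => u x * Real.log (u x) := hu.mul (hu.log fun x => by linarith [(hur x).1])
    have hvl : Continuous fun x => v x * Real.log (v x) := hv.mul (hv.log fun x => by linarith [(hvr x).1])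
    have hiu : Integrable (fun x => u x * Real.log (u x)) μ := integrable_of_continuous_of_compactSpace hul _
    have hiv : Integrable (fun x => v x * Real.log (v x)) μ := integrable_of_continuous_of_compactSpace hvl _
    have h1 : |(∫ x, u x * Real.log (u x) ∂μ) - ∫ x, v x * Real.log (v x) ∂μ| ≤ C * ε := by
      rw [← integral_sub hiu hiv]
      refine (abs_integral_le_integral_abs).trans ?_
      calc ∫ x, |u x * Real.log (u x) - v x * Real.log (v x)| ∂μ ≤ ∫ _x, C * ε ∂μ :=
            integral_mono (hiu.sub hiv).abs (integrable_const _) fun x =>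
              (hLip _ _ (hur x) (hvr x)).trans (mul_le_mul_of_nonneg_left (huv x) hC0)
        _ = C * ε := by simp
    have h2 : |(∫ x, u x ∂μ) * Real.log (∫ x, u x ∂μ) - (∫ x, v x ∂μ) * Real.log (∫ x, v x ∂μ)| ≤ C * ε :=
      (hLip _ _ (hmean_range hu hur) (hmean_range hv hvr)).trans (mul_le_mul_of_nonneg_left (hmean_close hu hv huv) hC0)
    have h1' := (abs_le.1 h1).2
    have h2' := (abs_le.1 h2).1
    linarith
  -- assemble
  have hba : ∀ x, |a x - b x| ≤ ε := fun x => by rw [abs_sub_comm]; exact hab x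
  have hqp : ∀ x : (GaugeConfig 3 L (Matrix.specialUnitaryGroup (Fin 2) ℂ)), |q (coords x) - p (coords x)| ≤ ε := fun x => by rw [abs_sub_comm]; exact (hpε' x).le
  have hpq : ∀ x : (GaugeConfig 3 L (Matrix.specialUnitaryGroup (Fin 2) ℂ)), |p (coords x) - q (coords x)| ≤ ε := fun x => (hpε' x).le
  have step1 := hEnt_close hac hbc harange hbrange hba
  have step2 := hEnt_close hPc hQc hPrange hQrange hpq
  have hexp1 : Real.exp (-c * t) ≤ 1 := by
    rw [Real.exp_le_one_iff]
    have : (0 : ℝ) ≤ t := t.coe_nonneg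
    nlinarith
  have hexp0 : 0 ≤ Real.exp (-c * t) := (Real.exp_pos _).le
  have hdp' : ((∫ x, b x * Real.log (b x) ∂μ) - (∫ x, b x ∂μ) * Real.log (∫ x, b x ∂μ)) ≤
      Real.exp (-c * t) * ((∫ x, p (coords x) * Real.log (p (coords x)) ∂μ) -
        (∫ x, p (coords x) ∂μ) * Real.log (∫ x, p (coords x) ∂μ)) := by
    rw [hb]; exact hdp
  have hgoal : ((∫ x, a x * Real.log (a x) ∂μ) - (∫ x, a x ∂μ) * Real.log (∫ x, a x ∂μ)) ≤
      Real.exp (-c * t) * ((∫ x, q (coords x) * Real.log (q (coords x)) ∂μ) -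
        (∫ x, q (coords x) ∂μ) * Real.log (∫ x, q (coords x) ∂μ)) + ε' := by
    have h3 : Real.exp (-c * t) * ((∫ x, p (coords x) * Real.log (p (coords x)) ∂μ) -
        (∫ x, p (coords x) ∂μ) * Real.log (∫ x, p (coords x) ∂μ)) ≤
        Real.exp (-c * t) * ((∫ x, q (coords x) * Real.log (q (coords x)) ∂μ) -
        (∫ x, q (coords x) ∂μ) * Real.log (∫ x, q (coords x) ∂μ)) + 2 * C * ε := by
      have h := mul_le_mul_of_nonneg_left step2 hexp0
      have h' : Real.exp (-c * t) * (2 * C * ε) ≤ 2 * C * ε := by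
        have hCε : 0 ≤ 2 * C * ε := by positivity
        nlinarith
      linarith [h, h']
    linarith [step1, hdp', h3, hε4]
  rw [ha] at hgoal
  exact hgoal

end Summit.QuantumFields.YangMills.Theorems.ColdStartUniversality
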